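import Summits.QuantumFields.BalabanUV.Beta.GAN24.CapacitanceClosedForm

/-!
# `BalabanUV.Beta.GAN24.CapacitanceClosedFormEnlarged` — binder row G-an2-4 / (CONV-C), road P1-fibre (crux A4/A5 of `SKELETON-P1.md`, strip step L10):
# the ZERO-ALIAS-ENLARGED capacitance system is solved in CLOSED FORM with NO division by `L₀` — the closed form crosses the cone `{L₀ = 0}`

NOT IN PRINT; OUR PROOF ATTEMPT.  HONEST FRAMING (cell contract, verbatim): «discharging `BetaPertH` makes Bałaban's UV stability UNCONDITIONAL — a real
constructive-QFT result; it is NOT the continuum limit and NOT the Clay problem.»  HONEST DEPENDENCY (verbatim): «continuum YM on T⁴ ⇐ BetaPertH ∧ nine spine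
estimates (0/9 proved); BetaPertH ⇐ (D1) ∧ (D4) ∧ CAP+tail; G-an2-4 gates asym, D1 and NE2/3/4.»  [folklore] finite-dimensional algebra over `ℂ` (no estimate, no
cited fact, no wall binder, no `def … : Prop` hypothesis: the `[shape]` predicate carries all its data as parameters and is asserted of nothing).  NOT summit
progress; nothing of (CONV-C)'s K-slot is discharged here.

## What is proved
`GAN24/CapacitanceClosedForm` (Y08f) solves the `(D+1)×(D+1)` capacitance system in closed form with denominators `a_κ, σ, h`; for the concrete fibre these are
`a_κ = ã_κ/L₀`, `σ = σ̃/L₀²`, `h = L₀·hSum ã δ δ'`, singular where the ZERO ALIAS's Laplacian symbol `L₀ = Σ_κ 4 sin²(p_κ/2N)` vanishes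
(`p = 0`, and the complex null cone, which meets every strip `|Im p| ≤ κ`).  THIS FILE keeps the zero alias's own unknowns `(A0, μ0)` instead of
eliminating them (the «enlarged» system `EnlBordered`: its EL/G rows (E1)/(E2) + the M/Q rows (E3)/(E4) with the OTHER aliases eliminated into the
diagonal-plus-rank-one capacitance scalars `a′, σ′` of Y08f §2) and proves (`enlBordered_iff_closedForm`) that under the zero alias's telescoping
identities (T1₀) `wQ0_κ ∂₀_κ = wM0 δ_κ`, (T2₀) `∂♭₀_κ wE0_κ = wG0 δ'_κ` it is solved EXPLICITLY AND UNIQUELY by formulas (`ACF, muCF, phiCF, cCF`) whose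
ONLY denominators are the REGULARISED scalars `ã_κ = wQ0_κ wE0_κ/2 + L₀ a′_κ` (`aReg`), `σ̃ = wM0 wG0 + L₀² σ′` (`sReg`),
`Ω = 1 − Σ_κ ∂♭₀_κ∂₀_κ a′_κ/ã_κ` (`Omega`), and the weights `wQ0_κ, wM0, wG0` — NO `1/L₀`, NO `1/h`, NO hypothesis on `L₀`: at `L₀ = ∂₀ = ∂♭₀ = 0` the
system is leaf-15's `CapacitanceSolveZero` reduced system, at `L₀ ≠ 0` it is Y08f's after eliminating `(A0, μ0)`; the closed form interpolates across
the cone.  KEY IDENTITY (`hSum_aReg_eq`, the product-level cancellation of the `p → 0` corner asked for in the typer's LEAVES.md v2.6 (M2)/(M3) caveat):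
`hSum ã δ δ' = 2 L₀ Ω/(wM0 wG0)` — Y08f's `h` carries the factor `L₀²` EXACTLY.
CONSEQUENCE (road (M3) to L10's (U1)/(U2), NOT proved here): invertibility and bounds of the fibre on a strip reduce to `L_m ≠ 0` for the other aliases and to
LOWER bounds for the scalars `|ã_κ|, |σ̃|, |Ω|` (all of order one in natural units on the real torus INCLUDING `p = 0`), i.e. to scalar alias-sum estimates.
-/

open Finset
open scoped BigOperators

namespace Summit.QuantumFields.BalabanUV.Beta.GAN24.CapacitanceClosedFormEnlarged

open FibreBlockSolve (dot)
open CapacitanceClosedForm (hSum)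

variable {D : ℕ}

/-! ## §1 The zero-alias data, the regularised scalars `ã, σ̃, Ω`, and the KEY IDENTITY `h̃ = 2 L₀ Ω / w₀` -/

/-- [folklore] DATA OF THE DISTINGUISHED («zero») ALIAS: its difference symbols `∂₀ = ∂̂(k₀)`, `∂♭₀`, Laplacian symbol `L₀ = ∂♭₀·∂₀`
(which MAY VANISH: `k₀ = p/N` on the complex null cone, or `p = 0`), and its four border weights (S1a: `wE0 = χ̂(0)s♭(0)`, `wG0 = χ̂(0)`,
`wM0 = S(0)`, `wQ0 = S(0)s(0)`).  No non-vanishing is assumed here. -/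
structure ZeroAlias (D : ℕ) where
  /-- forward difference symbol of the zero alias -/ dd0 : Fin D → ℂ
  /-- reflected difference symbol of the zero alias -/ db0 : Fin D → ℂ
  /-- Laplacian symbol of the zero alias (may vanish) -/ L0 : ℂ
  /-- EL-row border weight of the zero alias -/ wE0 : Fin D → ℂ
  /-- G-row border weight of the zero alias -/ wG0 : ℂ
  /-- M-row weight of the zero alias -/ wM0 : ℂ
  /-- Q-row weight of the zero alias -/ wQ0 : Fin D → ℂ
  /-- `∂♭₀ · ∂₀ = L₀` -/ dot_db0_dd0 : dot db0 dd0 = L0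

variable (Z : ZeroAlias D)
/-- [folklore] The REGULARISED diagonal scalar `ã_κ = wQ0_κ wE0_κ/2 + L₀·a′_κ` (`a′` = the diagonal alias sum over the OTHER aliases;
when `L₀ ≠ 0`, `ã_κ = L₀·a_κ` with `a_κ` the full diagonal alias sum of `CapacitanceClosedForm.aDiag`). -/
noncomputable def aReg (a' : Fin D → ℂ) (κ : Fin D) : ℂ := Z.wQ0 κ * Z.wE0 κ / 2 + Z.L0 * a' κ

/-- [folklore] The REGULARISED border scalar `σ̃ = wM0 wG0 + L₀²·σ′` (when `L₀ ≠ 0`, `σ̃ = L₀²·σ`). -/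
noncomputable def sReg (σ' : ℂ) : ℂ := Z.wM0 * Z.wG0 + Z.L0 ^ 2 * σ'

/-- [folklore] `ρ = Σ_κ ∂♭₀_κ ∂₀_κ · a′_κ/ã_κ` — the cone-corner defect (vanishes to fourth order at `p = 0` for the concrete weights). -/
noncomputable def rho (a' : Fin D → ℂ) : ℂ := ∑ κ, Z.db0 κ * Z.dd0 κ * a' κ / aReg Z a' κ

/-- [folklore] `Ω = 1 − ρ` — the ONLY new denominator of the enlarged closed form. -/
noncomputable def Omega (a' : Fin D → ℂ) : ℂ := 1 - rho Z a'

/-- [folklore] **THE KEY IDENTITY (product-level cancellation of the cone corner)**: under the zero-alias telescoping identities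
(T1₀) `wQ0_κ ∂₀_κ = wM0 δ_κ`, (T2₀) `∂♭₀_κ wE0_κ = wG0 δ'_κ` and `wM0, wG0, ã_κ ≠ 0`,
`hSum ã δ δ' = Σ_κ δ_κ δ'_κ/ã_κ = 2 L₀ Ω/(wM0 wG0)` — so Y08f's `h = Σ δδ'/a = L₀·hSum ã δ δ'` carries the factor `L₀²` EXACTLY, and `hSum ã/L₀`
is the cone-regular quantity `2Ω/w₀`. -/
theorem hSum_aReg_eq (a' δ δ' : Fin D → ℂ) (hT1 : ∀ κ, Z.wQ0 κ * Z.dd0 κ = Z.wM0 * δ κ)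
    (hT2 : ∀ κ, Z.db0 κ * Z.wE0 κ = Z.wG0 * δ' κ) (hM : Z.wM0 ≠ 0) (hG : Z.wG0 ≠ 0) (ha : ∀ κ, aReg Z a' κ ≠ 0) :
    hSum (aReg Z a') δ δ' = 2 * Z.L0 * Omega Z a' / (Z.wM0 * Z.wG0) := by
  have hδ : ∀ κ, δ κ = Z.wQ0 κ * Z.dd0 κ / Z.wM0 := fun κ => by rw [eq_div_iff hM, mul_comm, ← hT1 κ]
  have hδ' : ∀ κ, δ' κ = Z.db0 κ * Z.wE0 κ / Z.wG0 := fun κ => by rw [eq_div_iff hG, mul_comm, ← hT2 κ]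
  have hterm : ∀ κ, δ κ * δ' κ / aReg Z a' κ
      = 2 / (Z.wM0 * Z.wG0) * (Z.db0 κ * Z.dd0 κ) - 2 * Z.L0 / (Z.wM0 * Z.wG0) * (Z.db0 κ * Z.dd0 κ * a' κ / aReg Z a' κ) := by
    intro κ
    have hκ := ha κ
    have e : Z.wQ0 κ * Z.wE0 κ = 2 * aReg Z a' κ - 2 * Z.L0 * a' κ := by unfold aReg; ring
    rw [hδ κ, hδ' κ]
    have e2 : Z.wQ0 κ * Z.dd0 κ / Z.wM0 * (Z.db0 κ * Z.wE0 κ / Z.wG0) / aReg Z a' κ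
        = (Z.wQ0 κ * Z.wE0 κ) * (Z.db0 κ * Z.dd0 κ) / (Z.wM0 * Z.wG0 * aReg Z a' κ) := by
      field_simp
    rw [e2, e]
    field_simp
  unfold hSum Omega rho
  simp only [hterm, Finset.sum_sub_distrib, ← Finset.mul_sum]
  rw [show ∑ κ, Z.db0 κ * Z.dd0 κ = Z.L0 from Z.dot_db0_dd0]
  field_simp

/-! ## §2 The enlarged bordered system and its closed-form solution

Data: the zero alias `Z`, the capacitance scalars `a′, σ′` of the OTHER aliases (diagonal + rank-one border, `CapacitanceClosedForm.capP_eq`), and the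
alias-free coarse symbols `δ, δ'`.  Unknowns `(A0, μ0, φ, c)`; sources `(f0, γ0, r, Q)`.  The system (`EnlBordered`):
  (E1) `2(L₀ A0_κ − ∂₀_κ (∂♭₀·A0)) − L₀ ∂₀_κ μ0 − wE0_κ φ_κ = f0_κ`      (the zero alias's EL rows)
  (E2) `L₀ (∂♭₀·A0) − wG0 c = γ0`                                        (its G row)
  (E3) `wM0 μ0 − σ′ (δ'·φ) = r`                                           (the M row, other aliases eliminated)
  (E4) `wQ0_κ A0_κ + a′_κ φ_κ − (σ′/2) δ_κ (δ'·φ) + σ′ δ_κ c = Q_κ`         (the Q rows, other aliases eliminated). -/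

/-- [folklore] COEFFICIENT DATA of the enlarged system: the zero alias, the other-alias capacitance scalars `a′, σ′`, the coarse symbols `δ, δ'`. -/
structure EnlData (D : ℕ) extends ZeroAlias D where
  /-- diagonal capacitance scalar of the other aliases (`CapacitanceClosedForm.aDiag` of the good fibre) -/ a' : Fin D → ℂ
  /-- border capacitance scalar of the other aliases (`CapacitanceClosedForm.sigma` of the good fibre) -/ σ' : ℂ
  /-- coarse forward symbol `δ = ∂̂(p)` -/ δ : Fin D → ℂ
  /-- coarse reflected symbol `δ' = ∂̂♭(p)` -/ δ' : Fin D → ℂ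

variable (E : EnlData D)

/-- [shape] THE ZERO-ALIAS-ENLARGED BORDERED SYSTEM (E1)–(E4) for `(A0, μ0, φ, c)` with sources `(f0, γ0, r, Q)`.  Asserted of nothing. -/
def EnlBordered (Q f0 : Fin D → ℂ) (γ0 r : ℂ) (A0 : Fin D → ℂ) (μ0 : ℂ) (φ : Fin D → ℂ) (c : ℂ) : Prop :=
  (∀ κ, 2 * (E.L0 * A0 κ - E.dd0 κ * dot E.db0 A0) - E.L0 * E.dd0 κ * μ0 - E.wE0 κ * φ κ = f0 κ) ∧
    (E.L0 * dot E.db0 A0 - E.wG0 * c = γ0) ∧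
    (E.wM0 * μ0 - E.σ' * dot E.δ' φ = r) ∧
    (∀ κ, E.wQ0 κ * A0 κ + E.a' κ * φ κ - E.σ' / 2 * E.δ κ * dot E.δ' φ + E.σ' * E.δ κ * c = Q κ)

/-- [folklore] The combined `φ`-source `P_κ = 2 L₀ Q_κ − wQ0_κ f0_κ`. -/
def Psrc (Q f0 : Fin D → ℂ) (κ : Fin D) : ℂ := 2 * E.L0 * Q κ - E.wQ0 κ * f0 κ

/-- [folklore] `B₁ = Σ_κ δ'_κ P_κ/(2ã_κ)` (the source part of `δ'·φ`). -/
noncomputable def B1 (Q f0 : Fin D → ℂ) : ℂ := ∑ κ, E.δ' κ * Psrc E Q f0 κ / (2 * aReg E.toZeroAlias E.a' κ)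

/-- [folklore] `B_Q = Σ_κ ∂♭₀_κ Q_κ/wQ0_κ` (the source part of `∂♭₀·A0`). -/
noncomputable def BQ (Q : Fin D → ℂ) : ℂ := ∑ κ, E.db0 κ * Q κ / E.wQ0 κ

/-- [folklore] `B_φ = Σ_κ ∂♭₀_κ a′_κ P_κ/(2 wQ0_κ ã_κ)` (the source part of the `φ`-feedback into `∂♭₀·A0`). -/
noncomputable def Bphi (Q f0 : Fin D → ℂ) : ℂ := ∑ κ, E.db0 κ * E.a' κ * Psrc E Q f0 κ / (2 * E.wQ0 κ * aReg E.toZeroAlias E.a' κ)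

/-- [folklore] `U₀ = L₀ (2σ′γ0 − wG0 r)/wG0` (the source part of the folded scalar `U`). -/
noncomputable def U0 (γ0 r : ℂ) : ℂ := E.L0 * (2 * E.σ' * γ0 - E.wG0 * r) / E.wG0

/-- [folklore] `K = B_Q − B_φ + σ′L₀B₁/(2wM0) + σ′L₀γ0/(wM0 wG0)` (the source side of the scalar consistency equation for `t = ∂♭₀·A0`). -/
noncomputable def Kt (Q f0 : Fin D → ℂ) (γ0 : ℂ) : ℂ :=
  BQ E Q - Bphi E Q f0 + E.σ' * E.L0 * B1 E Q f0 / (2 * E.wM0) + E.σ' * E.L0 * γ0 / (E.wM0 * E.wG0)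

/-- [folklore] `M = (Ω σ̃/(wM0 wG0) − 1)/(2 wM0)` (the coefficient of `U` in the consistency equation). -/
noncomputable def Mt : ℂ := (Omega E.toZeroAlias E.a' * sReg E.toZeroAlias E.σ' / (E.wM0 * E.wG0) - 1) / (2 * E.wM0)

/-- [folklore] **CLOSED FORM of `t = ∂♭₀·A0`**: `t = w₀² (K + M U₀)/(Ω σ̃²)`, `w₀ = wM0 wG0` — denominators `Ω`, `σ̃` only. -/
noncomputable def tCF (Q f0 : Fin D → ℂ) (γ0 r : ℂ) : ℂ :=
  (E.wM0 * E.wG0) ^ 2 * (Kt E Q f0 γ0 + Mt E * U0 E γ0 r) / (Omega E.toZeroAlias E.a' * sReg E.toZeroAlias E.σ' ^ 2)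

/-- [folklore] CLOSED FORM of the folded scalar `U = −(2σ̃/wG0) t + U₀`. -/
noncomputable def UCF (Q f0 : Fin D → ℂ) (γ0 r : ℂ) : ℂ := -(2 * sReg E.toZeroAlias E.σ' / E.wG0) * tCF E Q f0 γ0 r + U0 E γ0 r

/-- [folklore] **CLOSED FORM of the block gauge constant** `c = (L₀ t − γ0)/wG0`. -/
noncomputable def cCF (Q f0 : Fin D → ℂ) (γ0 r : ℂ) : ℂ := (E.L0 * tCF E Q f0 γ0 r - γ0) / E.wG0

/-- [folklore] **CLOSED FORM of the constraint multiplier** `φ_κ = (P_κ + δ_κ U)/(2ã_κ)` — denominator `ã_κ`, regular across `{L₀ = 0}`. -/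
noncomputable def phiCF (Q f0 : Fin D → ℂ) (γ0 r : ℂ) : Fin D → ℂ :=
  fun κ => (Psrc E Q f0 κ + E.δ κ * UCF E Q f0 γ0 r) / (2 * aReg E.toZeroAlias E.a' κ)

/-- [folklore] CLOSED FORM of `u₁ = δ'·φ`: `u₁ = B₁ + U·L₀Ω/w₀` (the key identity `hSum ã δ δ' = 2L₀Ω/w₀` folded in). -/
noncomputable def u1CF (Q f0 : Fin D → ℂ) (γ0 r : ℂ) : ℂ :=
  B1 E Q f0 + UCF E Q f0 γ0 r * (E.L0 * Omega E.toZeroAlias E.a' / (E.wM0 * E.wG0))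

/-- [folklore] **CLOSED FORM of the zero alias's gauge multiplier** `μ0 = (r + σ′ u₁)/wM0`. -/
noncomputable def muCF (Q f0 : Fin D → ℂ) (γ0 r : ℂ) : ℂ := (r + E.σ' * u1CF E Q f0 γ0 r) / E.wM0

/-- [folklore] **CLOSED FORM of the zero alias's field** `A0_κ = (Q_κ − a′_κ φ_κ + (σ′/2) δ_κ u₁ − σ′ δ_κ c)/wQ0_κ` — NO `1/L₀`. -/
noncomputable def ACF (Q f0 : Fin D → ℂ) (γ0 r : ℂ) : Fin D → ℂ :=
  fun κ => (Q κ - E.a' κ * phiCF E Q f0 γ0 r κ + E.σ' / 2 * E.δ κ * u1CF E Q f0 γ0 r - E.σ' * E.δ κ * cCF E Q f0 γ0 r) / E.wQ0 κ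

/-! ### §2.1 Bookkeeping identities (finite sums) -/

/-- [folklore] For `φ` of the closed shape `φ_κ = (P_κ + δ_κ U)/(2ã_κ)`: `δ'·φ = B₁ + U·hSum ã δ δ'/2`. -/
theorem dot_δ'_of_shape (Q f0 : Fin D → ℂ) (U : ℂ) (φ : Fin D → ℂ)
    (hφ : ∀ κ, φ κ = (Psrc E Q f0 κ + E.δ κ * U) / (2 * aReg E.toZeroAlias E.a' κ)) :
    dot E.δ' φ = B1 E Q f0 + U * (hSum (aReg E.toZeroAlias E.a') E.δ E.δ' / 2) := by
  unfold dot B1 hSum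
  have h : ∀ κ, E.δ' κ * φ κ = E.δ' κ * Psrc E Q f0 κ / (2 * aReg E.toZeroAlias E.a' κ)
      + U * (E.δ κ * E.δ' κ / aReg E.toZeroAlias E.a' κ) / 2 := by
    intro κ; rw [hφ κ]; ring
  simp only [h, Finset.sum_add_distrib]
  rw [← Finset.sum_div, ← Finset.mul_sum]
  ring

/-- [folklore] Under (T1₀) and `wQ0_κ, wM0 ≠ 0`: `∂♭₀_κ δ_κ / wQ0_κ = ∂♭₀_κ ∂₀_κ / wM0`. -/
theorem db0_mul_δ_div (hT1 : ∀ κ, E.wQ0 κ * E.dd0 κ = E.wM0 * E.δ κ) (hQ : ∀ κ, E.wQ0 κ ≠ 0) (hM : E.wM0 ≠ 0) (κ : Fin D) :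
    E.db0 κ * E.δ κ / E.wQ0 κ = E.db0 κ * E.dd0 κ / E.wM0 := by
  rw [div_eq_div_iff (hQ κ) hM]
  linear_combination E.db0 κ * (hT1 κ).symm

/-- [folklore] For `A0` of the shape `wQ0_κ A0_κ = Q_κ − a′_κ φ_κ + (σ′/2) δ_κ u₁ − σ′ δ_κ c`:
`∂♭₀·A0 = B_Q − Σ_κ ∂♭₀_κ a′_κ φ_κ/wQ0_κ + (σ′/2) u₁ L₀/wM0 − σ′ c L₀/wM0` ((T1₀): `Σ_κ ∂♭₀_κ δ_κ/wQ0_κ = L₀/wM0`). -/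
theorem dot_db0_of_shape (Q φ A0 : Fin D → ℂ) (u₁ c : ℂ) (hT1 : ∀ κ, E.wQ0 κ * E.dd0 κ = E.wM0 * E.δ κ)
    (hQ : ∀ κ, E.wQ0 κ ≠ 0) (hM : E.wM0 ≠ 0)
    (hA : ∀ κ, E.wQ0 κ * A0 κ = Q κ - E.a' κ * φ κ + E.σ' / 2 * E.δ κ * u₁ - E.σ' * E.δ κ * c) :
    dot E.db0 A0 = BQ E Q - (∑ κ, E.db0 κ * E.a' κ * φ κ / E.wQ0 κ) + E.σ' / 2 * u₁ * (E.L0 / E.wM0)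
      - E.σ' * c * (E.L0 / E.wM0) := by
  have hA' : ∀ κ, A0 κ = (Q κ - E.a' κ * φ κ + E.σ' / 2 * E.δ κ * u₁ - E.σ' * E.δ κ * c) / E.wQ0 κ := by
    intro κ; rw [eq_div_iff (hQ κ), mul_comm]; exact hA κ
  have h : ∀ κ, E.db0 κ * A0 κ = E.db0 κ * Q κ / E.wQ0 κ - E.db0 κ * E.a' κ * φ κ / E.wQ0 κ
      + E.σ' / 2 * u₁ * (E.db0 κ * E.δ κ / E.wQ0 κ) - E.σ' * c * (E.db0 κ * E.δ κ / E.wQ0 κ) := by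
    intro κ; rw [hA' κ]; ring
  unfold dot BQ
  simp only [h, Finset.sum_add_distrib, Finset.sum_sub_distrib, ← Finset.mul_sum, db0_mul_δ_div E hT1 hQ hM, ← Finset.sum_div]
  rw [show ∑ κ, E.db0 κ * E.dd0 κ = E.L0 from E.dot_db0_dd0]

/-- [folklore] For `φ` of the closed shape: `Σ_κ ∂♭₀_κ a′_κ φ_κ/wQ0_κ = B_φ + U ρ/(2 wM0)`. -/
theorem sum_db0_a'_of_shape (Q f0 : Fin D → ℂ) (U : ℂ) (φ : Fin D → ℂ) (hT1 : ∀ κ, E.wQ0 κ * E.dd0 κ = E.wM0 * E.δ κ)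
    (hQ : ∀ κ, E.wQ0 κ ≠ 0) (hM : E.wM0 ≠ 0)
    (hφ : ∀ κ, φ κ = (Psrc E Q f0 κ + E.δ κ * U) / (2 * aReg E.toZeroAlias E.a' κ)) :
    ∑ κ, E.db0 κ * E.a' κ * φ κ / E.wQ0 κ = Bphi E Q f0 + U * rho E.toZeroAlias E.a' / (2 * E.wM0) := by
  have h : ∀ κ, E.db0 κ * E.a' κ * φ κ / E.wQ0 κ
      = E.db0 κ * E.a' κ * Psrc E Q f0 κ / (2 * E.wQ0 κ * aReg E.toZeroAlias E.a' κ)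
        + U * (E.db0 κ * E.δ κ / E.wQ0 κ) * (E.a' κ / aReg E.toZeroAlias E.a' κ) / 2 := by
    intro κ; rw [hφ κ]; ring
  have h2 : ∀ κ, U * (E.db0 κ * E.δ κ / E.wQ0 κ) * (E.a' κ / aReg E.toZeroAlias E.a' κ) / 2
      = U / (2 * E.wM0) * (E.db0 κ * E.dd0 κ * E.a' κ / aReg E.toZeroAlias E.a' κ) := by
    intro κ; rw [db0_mul_δ_div E hT1 hQ hM κ]; ring
  unfold Bphi rho
  simp only [h, h2, Finset.sum_add_distrib, ← Finset.mul_sum]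
  ring

/-! ### §2.2 The scalar consistency equation for `t = ∂♭₀·A0` -/

/-- [folklore] The right-hand side of the scalar consistency equation for `t = ∂♭₀·A0`, with `U = −(2σ̃/wG0)t + U₀`, `u₁ = B₁ + U L₀Ω/w₀`,
`c = (L₀t − γ0)/wG0` substituted. -/
noncomputable def consRHS (Q f0 : Fin D → ℂ) (γ0 r t : ℂ) : ℂ :=
  BQ E Q - (Bphi E Q f0 + (-(2 * sReg E.toZeroAlias E.σ' / E.wG0) * t + U0 E γ0 r) * rho E.toZeroAlias E.a' / (2 * E.wM0))
    + E.σ' / 2 * (B1 E Q f0 + (-(2 * sReg E.toZeroAlias E.σ' / E.wG0) * t + U0 E γ0 r)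
        * (E.L0 * Omega E.toZeroAlias E.a' / (E.wM0 * E.wG0))) * (E.L0 / E.wM0)
    - E.σ' * ((E.L0 * t - γ0) / E.wG0) * (E.L0 / E.wM0)

/-- [folklore] THE SCALAR CORE: `consRHS t − t = (K + M U₀) − t·Ω σ̃²/w₀²` (uses `σ̃ = w₀ + L₀²σ′`; `Ω` stays atomic). -/
theorem consistency_sub (Q f0 : Fin D → ℂ) (γ0 r t : ℂ) (hM : E.wM0 ≠ 0) (hG : E.wG0 ≠ 0) :
    consRHS E Q f0 γ0 r t - t = (Kt E Q f0 γ0 + Mt E * U0 E γ0 r)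
        - t * (Omega E.toZeroAlias E.a' * sReg E.toZeroAlias E.σ' ^ 2 / (E.wM0 * E.wG0) ^ 2) := by
  have hρ : rho E.toZeroAlias E.a' = 1 - Omega E.toZeroAlias E.a' := by unfold Omega; ring
  unfold consRHS Kt Mt sReg
  rw [hρ]
  field_simp
  ring

/-- [folklore] … hence the consistency equation `t = consRHS t` holds IFF `t = tCF` (`Ω, σ̃, wM0, wG0 ≠ 0`). -/
theorem consistency_iff (Q f0 : Fin D → ℂ) (γ0 r t : ℂ) (hM : E.wM0 ≠ 0) (hG : E.wG0 ≠ 0)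
    (hσ : sReg E.toZeroAlias E.σ' ≠ 0) (hΩ : Omega E.toZeroAlias E.a' ≠ 0) :
    t = consRHS E Q f0 γ0 r t ↔ t = tCF E Q f0 γ0 r := by
  have key := consistency_sub E Q f0 γ0 r t hM hG
  have hden : Omega E.toZeroAlias E.a' * sReg E.toZeroAlias E.σ' ^ 2 ≠ 0 := mul_ne_zero hΩ (pow_ne_zero 2 hσ)
  constructor
  · intro h
    have h1 := sub_eq_zero.mp (show (Kt E Q f0 γ0 + Mt E * U0 E γ0 r)
        - t * (Omega E.toZeroAlias E.a' * sReg E.toZeroAlias E.σ' ^ 2 / (E.wM0 * E.wG0) ^ 2) = 0 by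
      rw [← key]; exact sub_eq_zero.mpr h.symm)
    unfold tCF
    rw [eq_div_iff hden, h1]
    field_simp
  · intro h
    have h1 : (Kt E Q f0 γ0 + Mt E * U0 E γ0 r)
        = t * (Omega E.toZeroAlias E.a' * sReg E.toZeroAlias E.σ' ^ 2 / (E.wM0 * E.wG0) ^ 2) := by
      rw [h]; unfold tCF; field_simp
    have h2 : consRHS E Q f0 γ0 r t - t = 0 := by rw [key, h1, sub_self]
    exact (sub_eq_zero.mp h2).symm

/-! ### §2.3 The main theorem -/

/-- [folklore] `UCF` in unfolded form: `U = −2L₀σ′c − 2wM0 t − L₀ r` at `(t, c) = (tCF, cCF)`. -/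
theorem UCF_eq (Q f0 : Fin D → ℂ) (γ0 r : ℂ) (hG : E.wG0 ≠ 0) :
    UCF E Q f0 γ0 r = -(2 * E.L0 * E.σ' * cCF E Q f0 γ0 r) - 2 * E.wM0 * tCF E Q f0 γ0 r - E.L0 * r := by
  unfold UCF cCF U0 sReg
  field_simp
  ring

/-- [folklore] The closed-form `φ` has the closed shape (by definition). -/
theorem two_aReg_mul_phiCF (Q f0 : Fin D → ℂ) (γ0 r : ℂ) (ha : ∀ κ, aReg E.toZeroAlias E.a' κ ≠ 0) (κ : Fin D) :
    2 * aReg E.toZeroAlias E.a' κ * phiCF E Q f0 γ0 r κ = Psrc E Q f0 κ + E.δ κ * UCF E Q f0 γ0 r := by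
  unfold phiCF
  rw [mul_div_cancel₀ _ (mul_ne_zero two_ne_zero (ha κ))]

/-- [folklore] `δ'·phiCF = u1CF` (closed shape + the key identity). -/
theorem dot_δ'_phiCF (Q f0 : Fin D → ℂ) (γ0 r : ℂ) (hT1 : ∀ κ, E.wQ0 κ * E.dd0 κ = E.wM0 * E.δ κ)
    (hT2 : ∀ κ, E.db0 κ * E.wE0 κ = E.wG0 * E.δ' κ) (ha : ∀ κ, aReg E.toZeroAlias E.a' κ ≠ 0) (hM : E.wM0 ≠ 0)
    (hG : E.wG0 ≠ 0) : dot E.δ' (phiCF E Q f0 γ0 r) = u1CF E Q f0 γ0 r := by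
  rw [dot_δ'_of_shape E Q f0 (UCF E Q f0 γ0 r) (phiCF E Q f0 γ0 r) (fun κ => rfl),
    hSum_aReg_eq E.toZeroAlias E.a' E.δ E.δ' hT1 hT2 hM hG ha]
  unfold u1CF
  ring

/-- [folklore] The closed-form `A0` has the `Q`-row shape (by definition). -/
theorem wQ0_mul_ACF (Q f0 : Fin D → ℂ) (γ0 r : ℂ) (hQ : ∀ κ, E.wQ0 κ ≠ 0) (κ : Fin D) :
    E.wQ0 κ * ACF E Q f0 γ0 r κ = Q κ - E.a' κ * phiCF E Q f0 γ0 r κ + E.σ' / 2 * E.δ κ * u1CF E Q f0 γ0 r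
      - E.σ' * E.δ κ * cCF E Q f0 γ0 r := by
  unfold ACF
  rw [mul_div_cancel₀ _ (hQ κ)]

/-- [folklore] `∂♭₀·ACF = tCF` — the consistency equation is satisfied by the closed form. -/
theorem dot_db0_ACF (Q f0 : Fin D → ℂ) (γ0 r : ℂ) (hT1 : ∀ κ, E.wQ0 κ * E.dd0 κ = E.wM0 * E.δ κ)
    (hQ : ∀ κ, E.wQ0 κ ≠ 0) (hM : E.wM0 ≠ 0) (hG : E.wG0 ≠ 0) (hσ : sReg E.toZeroAlias E.σ' ≠ 0)
    (hΩ : Omega E.toZeroAlias E.a' ≠ 0) : dot E.db0 (ACF E Q f0 γ0 r) = tCF E Q f0 γ0 r := by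
  have h := dot_db0_of_shape E Q (phiCF E Q f0 γ0 r) (ACF E Q f0 γ0 r) (u1CF E Q f0 γ0 r) (cCF E Q f0 γ0 r) hT1 hQ hM
    (wQ0_mul_ACF E Q f0 γ0 r hQ)
  rw [sum_db0_a'_of_shape E Q f0 (UCF E Q f0 γ0 r) (phiCF E Q f0 γ0 r) hT1 hQ hM (fun κ => rfl)] at h
  have h2 := ((consistency_iff E Q f0 γ0 r (tCF E Q f0 γ0 r) hM hG hσ hΩ).2 rfl).symm
  unfold consRHS at h2
  rw [h]
  unfold u1CF cCF
  unfold UCF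
  linear_combination h2

/-- [folklore] **THE ZERO-ALIAS-ENLARGED BORDERED SYSTEM IS SOLVED BY THE CLOSED FORM, AND ONLY BY IT.**  Under the zero-alias telescoping identities
(T1₀)/(T2₀) and the non-vanishing of `ã_κ, wQ0_κ, wM0, wG0, σ̃, Ω` — and WITHOUT any hypothesis on `L₀` —
`EnlBordered E Q f0 γ0 r A0 μ0 φ c ↔ (A0, μ0, φ, c) = (ACF, muCF, phiCF, cCF)`. -/
theorem enlBordered_iff_closedForm (Q f0 : Fin D → ℂ) (γ0 r : ℂ) (hT1 : ∀ κ, E.wQ0 κ * E.dd0 κ = E.wM0 * E.δ κ)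
    (hT2 : ∀ κ, E.db0 κ * E.wE0 κ = E.wG0 * E.δ' κ) (ha : ∀ κ, aReg E.toZeroAlias E.a' κ ≠ 0) (hQ : ∀ κ, E.wQ0 κ ≠ 0)
    (hM : E.wM0 ≠ 0) (hG : E.wG0 ≠ 0) (hσ : sReg E.toZeroAlias E.σ' ≠ 0) (hΩ : Omega E.toZeroAlias E.a' ≠ 0)
    (A0 : Fin D → ℂ) (μ0 : ℂ) (φ : Fin D → ℂ) (c : ℂ) :
    EnlBordered E Q f0 γ0 r A0 μ0 φ c ↔
      (A0 = ACF E Q f0 γ0 r ∧ μ0 = muCF E Q f0 γ0 r ∧ φ = phiCF E Q f0 γ0 r ∧ c = cCF E Q f0 γ0 r) := by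
  constructor
  · rintro ⟨hE1, hE2, hE3, hE4⟩
    obtain ⟨t, ht⟩ : ∃ t, dot E.db0 A0 = t := ⟨_, rfl⟩
    obtain ⟨u₁, hu⟩ : ∃ u, dot E.δ' φ = u := ⟨_, rfl⟩
    simp only [ht] at hE1 hE2
    simp only [hu] at hE3 hE4
    obtain ⟨U, hUdef⟩ : ∃ U, -(2 * E.L0 * E.σ' * c) - 2 * E.wM0 * t - E.L0 * r = U := ⟨_, rfl⟩
    -- (E4) solved for the zero alias's field
    have hA : ∀ κ, E.wQ0 κ * A0 κ = Q κ - E.a' κ * φ κ + E.σ' / 2 * E.δ κ * u₁ - E.σ' * E.δ κ * c :=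
      fun κ => by linear_combination hE4 κ
    -- (E1)·wQ0 with (E4), (T1₀), (E3): the closed shape of φ
    have hφ2 : ∀ κ, 2 * aReg E.toZeroAlias E.a' κ * φ κ = Psrc E Q f0 κ + E.δ κ * U := by
      intro κ
      unfold aReg Psrc
      linear_combination (-E.wQ0 κ) * hE1 κ + (2 * E.L0) * hA κ + (-(2 * t + E.L0 * μ0)) * hT1 κ
        + (-(E.L0 * E.δ κ)) * hE3 + E.δ κ * hUdef
    have hφ : ∀ κ, φ κ = (Psrc E Q f0 κ + E.δ κ * U) / (2 * aReg E.toZeroAlias E.a' κ) := by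
      intro κ
      rw [eq_div_iff (mul_ne_zero two_ne_zero (ha κ))]
      linear_combination hφ2 κ
    -- (E2) solved for c
    have hc : c = (E.L0 * t - γ0) / E.wG0 := by
      rw [eq_div_iff hG]
      linear_combination (-1 : ℂ) * hE2
    -- the folded scalar U in terms of t alone
    have hU : U = -(2 * sReg E.toZeroAlias E.σ' / E.wG0) * t + U0 E γ0 r := by
      rw [← hUdef, hc]
      unfold sReg U0
      field_simp
      ring
    -- u₁ through the key identity
    have hu1 : u₁ = B1 E Q f0 + U * (E.L0 * Omega E.toZeroAlias E.a' / (E.wM0 * E.wG0)) := by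
      have h := dot_δ'_of_shape E Q f0 U φ hφ
      rw [hu, hSum_aReg_eq E.toZeroAlias E.a' E.δ E.δ' hT1 hT2 hM hG ha] at h
      rw [h]
      ring
    -- the consistency equation for t
    have htraw := dot_db0_of_shape E Q φ A0 u₁ c hT1 hQ hM hA
    rw [ht, sum_db0_a'_of_shape E Q f0 U φ hT1 hQ hM hφ, hu1, hc, hU] at htraw
    have htCF : t = tCF E Q f0 γ0 r :=
      (consistency_iff E Q f0 γ0 r t hM hG hσ hΩ).1 (by unfold consRHS; linear_combination htraw)
    -- read off the closed forms
    have hUCF : U = UCF E Q f0 γ0 r := by rw [hU, htCF]; rfl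
    have hcCF : c = cCF E Q f0 γ0 r := by rw [hc, htCF]; rfl
    have hφCF : φ = phiCF E Q f0 γ0 r := funext fun κ => by rw [hφ κ, hUCF]; rfl
    have hu1CF : u₁ = u1CF E Q f0 γ0 r := by rw [hu1, hUCF]; rfl
    have hμCF : μ0 = muCF E Q f0 γ0 r := by
      unfold muCF
      rw [eq_div_iff hM, ← hu1CF]
      linear_combination hE3
    have hACF : A0 = ACF E Q f0 γ0 r := by
      funext κ
      unfold ACF
      rw [eq_div_iff (hQ κ), ← hφCF, ← hu1CF, ← hcCF, mul_comm]
      exact hA κ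
    exact ⟨hACF, hμCF, hφCF, hcCF⟩
  · rintro ⟨rfl, rfl, rfl, rfl⟩
    have F1 := dot_δ'_phiCF E Q f0 γ0 r hT1 hT2 ha hM hG
    have F2 := dot_db0_ACF E Q f0 γ0 r hT1 hQ hM hG hσ hΩ
    have hAcf := wQ0_mul_ACF E Q f0 γ0 r hQ
    have hμ : E.wM0 * muCF E Q f0 γ0 r = r + E.σ' * u1CF E Q f0 γ0 r := by
      unfold muCF; rw [mul_div_cancel₀ _ hM]
    have hφ2 := two_aReg_mul_phiCF E Q f0 γ0 r ha
    have hUalt := UCF_eq E Q f0 γ0 r hG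
    refine ⟨fun κ => ?_, ?_, ?_, fun κ => ?_⟩
    · -- (E1): multiply by wQ0_κ ≠ 0
      rw [F2]
      have hmain : E.wQ0 κ * (2 * (E.L0 * ACF E Q f0 γ0 r κ - E.dd0 κ * tCF E Q f0 γ0 r)
          - E.L0 * E.dd0 κ * muCF E Q f0 γ0 r - E.wE0 κ * phiCF E Q f0 γ0 r κ - f0 κ) = 0 := by
        have hφ2κ := hφ2 κ
        unfold aReg Psrc at hφ2κ
        linear_combination (2 * E.L0) * hAcf κ + (-(2 * tCF E Q f0 γ0 r + E.L0 * muCF E Q f0 γ0 r)) * hT1 κ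
          + (-(E.L0 * E.δ κ)) * hμ + (-1 : ℂ) * hφ2κ + (-(E.δ κ)) * hUalt
      have h0 := (mul_eq_zero.mp hmain).resolve_left (hQ κ)
      exact sub_eq_zero.mp h0
    · -- (E2)
      rw [F2]
      unfold cCF
      rw [mul_div_cancel₀ _ hG]
      ring
    · -- (E3)
      rw [F1, hμ]
      ring
    · -- (E4)
      rw [F1, hAcf κ]
      ring

end Summit.QuantumFields.BalabanUV.Beta.GAN24.CapacitanceClosedFormEnlarged
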